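import Literature.InformationTheory.Coding.SourcePolarizationStepRecursion
import Literature.InformationTheory.Coding.SourcePolarizationStepMinus
import Literature.InformationTheory.Coding.SourcePolarizationStepBounds
import HarnessLib

/-!
# Fine two-sided polarization with a polynomially small unpolarized fraction (`PolarizeFine_holds`)

Theorem-only companion of `Literature/InformationTheory/Coding/SourcePolarization.lean`: the proof
of the named fact `PolarizeFine` — there are absolute `μ > 0`, `C` (here `μ = 3/1024`, `C = 512`)
such that for every binary source with functional side information and every block length `2^n`
at most `C · 2^{(1−μ)n}` indices `j` have `H(U_j | U_{<j}, Y) ∈ (2^{-2^{⌊n/4⌋}}, 1 − 2^{-2^{⌊n/4⌋}})`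
[Korada–Urbanke 2010, Thm 16 with Lemma 17 for the high-entropy end; Arıkan–Telatar 2009 for the
low end], from the one-step relations proved in the `SourcePolarizationStep*.lean` companions
(`Z(S⁺) = Z²`, `Z√(2−Z²) ≤ Z(S⁻) ≤ 2Z − Z²`, `Z² ≤ H ≤ log₂(1+Z)`, and the recursion
`leak g (s+1) j = leak g⁻ s j`, `leak g (s+1) (2^s + j) = leak g⁺ s j`).

## The argument (following print)

Korada–Urbanke [Thm 16]: next to the Bhattacharyya process `Z` (`Z⁺ = Z²`, `Z⁻ ≤ 2Z`) consider the
mirror process `X = 1 − Z²`, which by Lemma 17 (`Z(S⁻) ≥ Z√(2 − Z²)`) satisfies `X⁻ ≤ X²`,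
`X⁺ = 1 − Z⁴ ≤ 2X`; "by adapting the proof of [ArT08]" both are doubly-exponentially small outside
an exceptional set.  We make the adaptation quantitative and uniform in the source:

* §A — leaves `tleaf lo hi a s j` of the complete binary tree of two maps (natural index order, top
  bit first), splitting/composition/symmetry of sums over leaves, and the potential bound
  `Σ_leaves F ≤ θ^s F(root)` when `F(lo a) + F(hi a) ≤ θ F(a)`;
* §B — path statistics of a leaf index (`nhi`, `nlo`, `initLo`, `hasLoRun`) with the two counting
  facts: `#{j : nhi j < K} · 2^{s+1−K} ≤ 3^s` (Chernoff with `t = ½`: `Σ_j 2^{nlo j} = 3^s`) and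
  `#{j : a run of R lo-steps} · 2^R ≤ s 2^s` (union bound);
* §C — the Arıkan–Telatar bootstrapping in deterministic form (`le_rpow_of_path`): for a process
  `v ≥ 0` with `v(hi a) ≤ v(a)²`, `v(lo a) ≤ 2 v(a)`, from `v ≤ 2^{-ℓ}` a path with `K` squarings,
  initial lo-run `≤ c` and no lo-run of length `R` ends at `v ≤ 2^{-2^K (ℓ − c − R)}`; hence from
  `v ≤ 2^{-2R}` all but `3^s/2^{s+1−K} + s2^s/2^R` leaves have `v ≤ 2^{-2^K}` (`card_lt_v_tleaf_le`);
* §D — for sources: `leak S.g s j = H(tleaf minus plus S s j)`; the potential `φ = √(Z(1−Z²))`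
  contracts, `φ(S⁻) + φ(S⁺) ≤ 1.9 φ(S)` (`pot_step`: by `Z⁺ = Z²`, `Z⁻ ≤ 2Z−Z²`, `1−(Z⁻)² ≤ (1−Z²)²`
  this reduces to `√(z(1+z²)) + √((2−z)(1−z²)) ≤ 1.9` on `[0,1]`, a quartic polynomial inequality),
  so `Σ_leaves φ ≤ 1.9^s` (rough polarization with rate `log₂(2/1.9)`), and the process hypotheses
  for `Z` (tree `(minus, plus)`) and `X = 1 − Z²` (tree `(plus, minus)`, same leaves);
* §E — the two-phase count `card_window_le` (rough phase `n₀`, fine phase `m`, thresholds `R`, `K`)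
  and the choice `k = ⌊n/1024⌋ ≥ 3`, `n₀ = 266k`, `R = 8k`, `K = ⌊n/4⌋+1`, giving `≤ 3 · 2^{n−3k}`;
  `n < 3072` is absorbed by `C` (`PolarizeFine_holds`).

Deviations from print: print's statements are asymptotic (`lim inf`, any `β < 1/2`) for one fixed
B-DMC; here `β = 1/4` with explicit absolute constants, uniformly over all binary sources with
functional side information and uniform input (the class of `SourcePolarization.lean`), and the
rough phase uses a contracting potential [Mondelli–Hassani–Urbanke 2016, Lemmas 5–6] in place of
the martingale convergence theorem.

## References

* S. B. Korada, R. Urbanke, *Polar codes are optimal for lossy source coding*, IEEE Trans. IT 56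
  (2010) 1751–1768, Thm 16, Lemma 17 (arXiv:0903.0307, Appendix).  bib `KoradaUrbanke2010`.
* E. Arıkan, E. Telatar, *On the rate of channel polarization*, Proc. IEEE ISIT 2009, Thm 1 and
  §III.  bib `ArikanTelatar2009`.
* M. Mondelli, S. H. Hassani, R. Urbanke, *Unified scaling of polar codes*, IEEE Trans. IT 62
  (2016), Lemmas 5–6.  bib `MondelliHassaniUrbanke2016`.
* E. Arıkan, *Source polarization*, Proc. IEEE ISIT 2010, Thm 1, Prop. 2.  bib `Arikan2010`.
* E. Arıkan, *Channel polarization…*, IEEE Trans. IT 55 (2009), Prop. 5.  bib `Arikan2009`.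
-/

noncomputable section

namespace Literature.InformationTheory.Coding.Polar

open Finset Literature.InformationTheory.Entropy

/-! ### A. Leaves of a complete binary tree, indexed in natural order (top bit first) -/

section Tree

variable {α : Type*} (lo hi : α → α)

/-- Leaf `j` at depth `s` below `a` in the complete binary tree generated by the two maps `lo`, `hi`:
the TOP bit of `j` chooses the first step (`j < 2^(s-1)`: `lo`), then recurse. [folklore] -/
def tleaf : α → (s : ℕ) → Fin (2 ^ s) → α
  | a, 0, _ => a
  | a, s + 1, j =>
    if h : j.val < 2 ^ s then tleaf (lo a) s ⟨j.val, h⟩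
    else tleaf (hi a) s ⟨j.val - 2 ^ s, by have := j.isLt; have := two_pow_succ_eq s; omega⟩

/-- Depth `0`: the root. [folklore] -/
@[simp] theorem tleaf_zero (a : α) (j : Fin (2 ^ 0)) : tleaf lo hi a 0 j = a := rfl

/-- Low half: first step `lo`. [folklore] -/
@[simp] theorem tleaf_succ_lo (a : α) (s : ℕ) (j : Fin (2 ^ s)) :
    tleaf lo hi a (s + 1) (loIdx s j) = tleaf lo hi (lo a) s j := by
  simp [tleaf]

/-- High half: first step `hi`. [folklore] -/
@[simp] theorem tleaf_succ_hi (a : α) (s : ℕ) (j : Fin (2 ^ s)) :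
    tleaf lo hi a (s + 1) (hiIdx s j) = tleaf lo hi (hi a) s j := by
  simp [tleaf]

/-- Splitting a sum over the leaves at depth `s + 1` on the first step. [folklore] -/
theorem sum_tleaf_succ {M : Type*} [AddCommMonoid M] (F : α → M) (a : α) (s : ℕ) :
    ∑ j : Fin (2 ^ (s + 1)), F (tleaf lo hi a (s + 1) j) =
      ∑ j : Fin (2 ^ s), F (tleaf lo hi (lo a) s j) + ∑ j : Fin (2 ^ s), F (tleaf lo hi (hi a) s j) := by
  rw [sum_univ_two_pow_succ]
  simp

/-- Leaves at depth `n₀ + m` are the depth-`m` leaves below the depth-`n₀` leaves. [folklore] -/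
theorem sum_tleaf_add {M : Type*} [AddCommMonoid M] (F : α → M) (n₀ m : ℕ) (a : α) :
    ∑ j : Fin (2 ^ (n₀ + m)), F (tleaf lo hi a (n₀ + m) j) =
      ∑ i : Fin (2 ^ n₀), ∑ j : Fin (2 ^ m), F (tleaf lo hi (tleaf lo hi a n₀ i) m j) := by
  induction n₀ generalizing a with
  | zero =>
    rw [Nat.zero_add]
    simp
  | succ n ih =>
    rw [Nat.succ_add, sum_tleaf_succ, ih, ih,
      sum_tleaf_succ lo hi (fun b => ∑ j : Fin (2 ^ m), F (tleaf lo hi b m j))]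

/-- Swapping the two maps permutes the leaves: sums over leaves are unchanged. [folklore] -/
theorem sum_tleaf_swap {M : Type*} [AddCommMonoid M] (F : α → M) (s : ℕ) (a : α) :
    ∑ j : Fin (2 ^ s), F (tleaf lo hi a s j) = ∑ j : Fin (2 ^ s), F (tleaf hi lo a s j) := by
  induction s generalizing a with
  | zero => simp
  | succ s ih => rw [sum_tleaf_succ, sum_tleaf_succ, ih, ih, add_comm]

/-- **Potential bound**: if `F ≥ 0` contracts on average by `θ` at every node,
`F (lo a) + F (hi a) ≤ θ F a`, then the sum of `F` over the `2^s` leaves at depth `s` is at most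
`θ^s F a`. [folklore] -/
theorem sum_tleaf_le_pow (F : α → ℝ) (θ : ℝ) (hθ : 0 ≤ θ)
    (hF : ∀ a, F (lo a) + F (hi a) ≤ θ * F a) (s : ℕ) (a : α) :
    ∑ j : Fin (2 ^ s), F (tleaf lo hi a s j) ≤ θ ^ s * F a := by
  induction s generalizing a with
  | zero => simp
  | succ s ih =>
    rw [sum_tleaf_succ]
    calc _ ≤ θ ^ s * F (lo a) + θ ^ s * F (hi a) := add_le_add (ih _) (ih _)
      _ = θ ^ s * (F (lo a) + F (hi a)) := by ring
      _ ≤ θ ^ s * (θ * F a) := mul_le_mul_of_nonneg_left (hF a) (pow_nonneg hθ s)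
      _ = θ ^ (s + 1) * F a := by ring

end Tree

/-! ### B. Path statistics of a leaf index: number of `hi`/`lo` steps, runs of `lo` steps -/

section Paths

/-- A `Fin (2^(s+1))` index minus `2^s`, as an index of the high half (junk if `j < 2^s`).
[folklore] -/
theorem sub_two_pow_lt {s : ℕ} (j : Fin (2 ^ (s + 1))) (h : ¬ j.val < 2 ^ s) :
    j.val - 2 ^ s < 2 ^ s := by
  have := j.isLt; have := two_pow_succ_eq s; omega

/-- Number of `hi` steps on the path to leaf `j` at depth `s` (the number of one bits of `j`).
[folklore] -/
def nhi : (s : ℕ) → Fin (2 ^ s) → ℕ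
  | 0, _ => 0
  | s + 1, j =>
    if h : j.val < 2 ^ s then nhi s ⟨j.val, h⟩ else nhi s ⟨j.val - 2 ^ s, sub_two_pow_lt j h⟩ + 1

/-- Number of `lo` steps on the path to leaf `j` at depth `s`. [folklore] -/
def nlo : (s : ℕ) → Fin (2 ^ s) → ℕ
  | 0, _ => 0
  | s + 1, j =>
    if h : j.val < 2 ^ s then nlo s ⟨j.val, h⟩ + 1 else nlo s ⟨j.val - 2 ^ s, sub_two_pow_lt j h⟩

/-- Length of the initial run of `lo` steps on the path to leaf `j`. [folklore] -/
def initLo : (s : ℕ) → Fin (2 ^ s) → ℕ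
  | 0, _ => 0
  | s + 1, j => if h : j.val < 2 ^ s then initLo s ⟨j.val, h⟩ + 1 else 0

/-- The path to leaf `j` contains `R` consecutive `lo` steps (always true for `R = 0`; a `Bool`,
so that counting needs no choice of decidability instances). [folklore] -/
def hasLoRun (R : ℕ) : (s : ℕ) → Fin (2 ^ s) → Bool
  | 0, _ => decide (R = 0)
  | s + 1, j => decide (R ≤ initLo (s + 1) j) ||
      (if h : j.val < 2 ^ s then hasLoRun R s ⟨j.val, h⟩
        else hasLoRun R s ⟨j.val - 2 ^ s, sub_two_pow_lt j h⟩)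

variable {s : ℕ}

/-- No steps at depth `0`. [folklore] -/
@[simp] theorem nhi_zero (j : Fin (2 ^ 0)) : nhi 0 j = 0 := rfl

/-- No steps at depth `0`. [folklore] -/
@[simp] theorem nlo_zero (j : Fin (2 ^ 0)) : nlo 0 j = 0 := rfl

/-- No steps at depth `0`. [folklore] -/
@[simp] theorem initLo_zero (j : Fin (2 ^ 0)) : initLo 0 j = 0 := rfl

/-- At depth `0` only the empty run exists. [folklore] -/
@[simp] theorem hasLoRun_zero (R : ℕ) (j : Fin (2 ^ 0)) : hasLoRun R 0 j = decide (R = 0) := rfl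

/-- A first `lo` step does not count as a `hi` step. [folklore] -/
@[simp] theorem nhi_succ_lo (j : Fin (2 ^ s)) : nhi (s + 1) (loIdx s j) = nhi s j := by
  simp [nhi]

/-- A first `hi` step counts as one `hi` step. [folklore] -/
@[simp] theorem nhi_succ_hi (j : Fin (2 ^ s)) : nhi (s + 1) (hiIdx s j) = nhi s j + 1 := by
  simp [nhi]

/-- A first `lo` step counts as one `lo` step. [folklore] -/
@[simp] theorem nlo_succ_lo (j : Fin (2 ^ s)) : nlo (s + 1) (loIdx s j) = nlo s j + 1 := by
  simp [nlo]

/-- A first `hi` step does not count as a `lo` step. [folklore] -/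
@[simp] theorem nlo_succ_hi (j : Fin (2 ^ s)) : nlo (s + 1) (hiIdx s j) = nlo s j := by
  simp [nlo]

/-- A first `lo` step extends the initial run. [folklore] -/
@[simp] theorem initLo_succ_lo (j : Fin (2 ^ s)) : initLo (s + 1) (loIdx s j) = initLo s j + 1 := by
  simp [initLo]

/-- A first `hi` step ends the initial run. [folklore] -/
@[simp] theorem initLo_succ_hi (j : Fin (2 ^ s)) : initLo (s + 1) (hiIdx s j) = 0 := by
  simp [initLo]

/-- Runs after a first `lo` step. [folklore] -/
theorem hasLoRun_succ_lo (R : ℕ) (j : Fin (2 ^ s)) :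
    hasLoRun R (s + 1) (loIdx s j) = true ↔ R ≤ initLo s j + 1 ∨ hasLoRun R s j = true := by
  simp [hasLoRun]

/-- Runs after a first `hi` step. [folklore] -/
theorem hasLoRun_succ_hi (R : ℕ) (j : Fin (2 ^ s)) :
    hasLoRun R (s + 1) (hiIdx s j) = true ↔ R = 0 ∨ hasLoRun R s j = true := by
  simp [hasLoRun]

/-- `nhi + nlo = depth`. [folklore] -/
theorem nhi_add_nlo : ∀ (s : ℕ) (j : Fin (2 ^ s)), nhi s j + nlo s j = s
  | 0, _ => rfl
  | s + 1, j => by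
    rcases eq_loIdx_or_eq_hiIdx s j with ⟨c, rfl⟩ | ⟨c, rfl⟩
    · rw [nhi_succ_lo, nlo_succ_lo, ← add_assoc, nhi_add_nlo s c]
    · rw [nhi_succ_hi, nlo_succ_hi, add_right_comm, nhi_add_nlo s c]

/-- A long initial run is a run. [folklore] -/
theorem hasLoRun_of_le_initLo {R : ℕ} : ∀ {s : ℕ} {j : Fin (2 ^ s)},
    R ≤ initLo s j → hasLoRun R s j = true
  | 0, _, h => by simpa using Nat.le_zero.1 h
  | _ + 1, _, h => by
    unfold hasLoRun
    rw [Bool.or_eq_true, decide_eq_true_eq]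
    exact Or.inl h

/-- Splitting a count over `Fin (2^(s+1))` into the low and the high half. [folklore] -/
theorem card_filter_two_pow_succ (s : ℕ) (P : Fin (2 ^ (s + 1)) → Prop) [DecidablePred P] :
    (univ.filter P).card =
      (univ.filter fun c : Fin (2 ^ s) => P (loIdx s c)).card +
        (univ.filter fun c : Fin (2 ^ s) => P (hiIdx s c)).card := by
  simp only [Finset.card_filter]
  exact sum_univ_two_pow_succ s _

/-- **Generating function of the number of `lo` steps**: `Σ_j 2^{nlo j} = 3^s`. [folklore] -/
theorem sum_two_pow_nlo : ∀ s : ℕ, ∑ j : Fin (2 ^ s), (2 : ℕ) ^ nlo s j = 3 ^ s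
  | 0 => by simp
  | s + 1 => by
    rw [sum_univ_two_pow_succ]
    simp only [nlo_succ_lo, nlo_succ_hi, pow_succ, ← Finset.sum_mul, sum_two_pow_nlo s]
    ring

/-- **Binomial tail**: the number of leaves at depth `s` reached with fewer than `K` `hi` steps is at
most `3^s / 2^{s+1-K}` (Chernoff with `t = 1/2`: such a leaf has `nlo ≥ s + 1 - K`, and
`Σ_j 2^{nlo j} = 3^s`). [folklore] -/
theorem card_nhi_lt_mul_le (s K : ℕ) :
    (univ.filter fun j : Fin (2 ^ s) => nhi s j < K).card * 2 ^ (s + 1 - K) ≤ 3 ^ s := by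
  rw [← sum_two_pow_nlo s, Finset.card_eq_sum_ones, Finset.sum_mul, one_mul]
  calc ∑ j ∈ univ.filter (fun j : Fin (2 ^ s) => nhi s j < K), (2 : ℕ) ^ (s + 1 - K)
      ≤ ∑ j ∈ univ.filter (fun j : Fin (2 ^ s) => nhi s j < K), 2 ^ nlo s j := by
        refine Finset.sum_le_sum fun j hj => ?_
        have hj := (Finset.mem_filter.1 hj).2
        have := nhi_add_nlo s j
        exact Nat.pow_le_pow_right two_pos (by omega)
    _ ≤ ∑ j, 2 ^ nlo s j :=
        Finset.sum_le_sum_of_subset_of_nonneg (Finset.filter_subset _ _) fun _ _ _ => Nat.zero_le _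

/-- The number of leaves whose path STARTS with `R` `lo` steps, times `2^R`, is at most `2^s`.
[folklore] -/
theorem card_le_initLo_mul_le : ∀ (s R : ℕ),
    (univ.filter fun j : Fin (2 ^ s) => R ≤ initLo s j).card * 2 ^ R ≤ 2 ^ s
  | s, 0 => by simp
  | 0, R + 1 => by
    rw [Finset.card_eq_zero.2, zero_mul]
    · exact Nat.zero_le _
    · rw [Finset.filter_eq_empty_iff]
      intro j _
      simp
  | s + 1, R + 1 => by
    rw [card_filter_two_pow_succ]
    simp only [initLo_succ_lo, initLo_succ_hi, add_le_add_iff_right, Nat.le_zero,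
      Nat.add_one_ne_zero, Finset.filter_false, Finset.card_empty, add_zero]
    calc (univ.filter fun c : Fin (2 ^ s) => R ≤ initLo s c).card * 2 ^ (R + 1)
        = (univ.filter fun c : Fin (2 ^ s) => R ≤ initLo s c).card * 2 ^ R * 2 := by ring
      _ ≤ 2 ^ s * 2 := Nat.mul_le_mul_right 2 (card_le_initLo_mul_le s R)
      _ = 2 ^ (s + 1) := (pow_succ 2 s).symm

/-- **Long runs are rare**: the number of leaves at depth `s` whose path contains `R` consecutive
`lo` steps, times `2^R`, is at most `s · 2^s` (union bound over the position of the run).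
[folklore] -/
theorem card_hasLoRun_mul_le (R : ℕ) (hR : 0 < R) : ∀ s : ℕ,
    (univ.filter fun j : Fin (2 ^ s) => hasLoRun R s j = true).card * 2 ^ R ≤ s * 2 ^ s
  | 0 => by
    have h : (univ.filter fun j : Fin (2 ^ 0) => hasLoRun R 0 j = true) = ∅ := by
      rw [Finset.filter_eq_empty_iff]
      intro j _
      simp only [hasLoRun_zero, decide_eq_true_eq]
      omega
    rw [h]
    simp
  | s + 1 => by
    have hsplit : (univ.filter fun j : Fin (2 ^ (s + 1)) => hasLoRun R (s + 1) j = true) ⊆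
        (univ.filter fun j : Fin (2 ^ (s + 1)) => R ≤ initLo (s + 1) j) ∪
          (univ.filter fun j : Fin (2 ^ (s + 1)) =>
            (if h : j.val < 2 ^ s then hasLoRun R s ⟨j.val, h⟩
              else hasLoRun R s ⟨j.val - 2 ^ s, sub_two_pow_lt j h⟩) = true) := by
      intro j hj
      rw [Finset.mem_union, Finset.mem_filter, Finset.mem_filter]
      have hj := (Finset.mem_filter.1 hj).2
      unfold hasLoRun at hj
      rw [Bool.or_eq_true, decide_eq_true_eq] at hj
      rcases hj with h | h
      · exact Or.inl ⟨mem_univ _, h⟩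
      · exact Or.inr ⟨mem_univ _, h⟩
    have hrec : (univ.filter fun j : Fin (2 ^ (s + 1)) =>
        (if h : j.val < 2 ^ s then hasLoRun R s ⟨j.val, h⟩
          else hasLoRun R s ⟨j.val - 2 ^ s, sub_two_pow_lt j h⟩) = true).card =
        2 * (univ.filter fun j : Fin (2 ^ s) => hasLoRun R s j = true).card := by
      rw [card_filter_two_pow_succ, two_mul]
      congr 1
      · congr 1
        ext c
        simp
      · congr 1
        ext c
        simp
    calc (univ.filter fun j : Fin (2 ^ (s + 1)) => hasLoRun R (s + 1) j = true).card * 2 ^ R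
        ≤ ((univ.filter fun j : Fin (2 ^ (s + 1)) => R ≤ initLo (s + 1) j).card +
            2 * (univ.filter fun j : Fin (2 ^ s) => hasLoRun R s j = true).card) * 2 ^ R := by
          rw [← hrec]
          exact Nat.mul_le_mul_right _ ((Finset.card_le_card hsplit).trans (Finset.card_union_le _ _))
      _ = (univ.filter fun j : Fin (2 ^ (s + 1)) => R ≤ initLo (s + 1) j).card * 2 ^ R +
            2 * ((univ.filter fun j : Fin (2 ^ s) => hasLoRun R s j = true).card * 2 ^ R) := by ring
      _ ≤ 2 ^ (s + 1) + 2 * (s * 2 ^ s) :=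
          add_le_add (card_le_initLo_mul_le (s + 1) R)
            (Nat.mul_le_mul_left 2 (card_hasLoRun_mul_le R hR s))
      _ = (s + 1) * 2 ^ (s + 1) := by rw [pow_succ]; ring

end Paths

/-! ### C. The bootstrapping lemma for a process `v⁺ ≤ v²` (`hi` step), `v⁻ ≤ 2v` (`lo` step) -/

section Process

variable {α : Type*} (lo hi : α → α) (v : α → ℝ)

/-- **Arıkan–Telatar bootstrapping, deterministic form.**  Let `v ≥ 0` square (at least) along
`hi` steps and at most double along `lo` steps.  If `v a ≤ 2^{-ℓ}`, the path to leaf `j` starts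
with at most `c` `lo` steps and contains no run of `R` consecutive `lo` steps, then
`v (leaf j) ≤ 2^{-2^{K} (ℓ - c - R)}`, `K` the number of `hi` steps on the path: writing the bound
as `2^{-L}`, a `lo` step costs `L ↦ L - 1`, a `hi` step gives `L ↦ 2L`, so `L · 2^{-#hi}` drops by
at most `Σ_k r_k 2^{-k} ≤ c + R (1/2 + 1/4 + …)`, `r_k < R` the length of the `k`-th run of `lo`
steps. [cite: ArikanTelatar2009, §III (proof of Thm 1: Z_{i+1} = Z_i² or ≤ 2 Z_i along the path)] -/
theorem le_rpow_of_path (hv0 : ∀ a, 0 ≤ v a) (hsq : ∀ a, v (hi a) ≤ v a ^ 2)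
    (hdb : ∀ a, v (lo a) ≤ 2 * v a) (R : ℕ) :
    ∀ (s : ℕ) (j : Fin (2 ^ s)) (a : α) (ℓ c : ℝ), v a ≤ (2 : ℝ) ^ (-ℓ) →
      (initLo s j : ℝ) ≤ c → hasLoRun R s j = false →
        v (tleaf lo hi a s j) ≤ (2 : ℝ) ^ (-(2 ^ nhi s j * (ℓ - c - R)))
  | 0, j, a, ℓ, c, ha, hc, _ => by
    simp only [tleaf_zero, nhi_zero, pow_zero, one_mul]
    refine ha.trans (Real.rpow_le_rpow_of_exponent_le one_le_two ?_)
    simp only [initLo_zero, CharP.cast_eq_zero] at hc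
    linarith [(Nat.cast_nonneg R : (0 : ℝ) ≤ R)]
  | s + 1, j, a, ℓ, c, ha, hc, hrun => by
    rcases eq_loIdx_or_eq_hiIdx s j with ⟨j, rfl⟩ | ⟨j, rfl⟩
    · -- first step `lo`: `v` at most doubles, the initial run shortens by one
      rw [tleaf_succ_lo, nhi_succ_lo]
      rw [initLo_succ_lo, Nat.cast_add, Nat.cast_one] at hc
      rw [← Bool.not_eq_true, hasLoRun_succ_lo, not_or, Bool.not_eq_true] at hrun
      have ha' : v (lo a) ≤ (2 : ℝ) ^ (-(ℓ - 1)) := by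
        calc v (lo a) ≤ 2 * v a := hdb a
          _ ≤ 2 * (2 : ℝ) ^ (-ℓ) := by linarith
          _ = (2 : ℝ) ^ (-(ℓ - 1)) := by
              rw [show -(ℓ - 1) = 1 + -ℓ by ring, Real.rpow_add two_pos, Real.rpow_one]
      have h := le_rpow_of_path hv0 hsq hdb R s j (lo a) (ℓ - 1) (c - 1) ha' (by linarith) hrun.2
      convert h using 3
      ring
    · -- first step `hi`: `v` squares, a new run of `lo` steps (of length `< R`) may start
      rw [tleaf_succ_hi, nhi_succ_hi]
      rw [initLo_succ_hi, Nat.cast_zero] at hc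
      rw [← Bool.not_eq_true, hasLoRun_succ_hi, not_or, Bool.not_eq_true] at hrun
      have hR : initLo s j + 1 ≤ R := by
        by_contra h
        have h' := hasLoRun_of_le_initLo (s := s) (j := j) (R := R) (by omega)
        rw [hrun.2] at h'
        exact Bool.false_ne_true h'
      have hc' : (initLo s j : ℝ) ≤ R - 1 := by
        have : ((initLo s j + 1 : ℕ) : ℝ) ≤ R := by exact_mod_cast hR
        push_cast at this
        linarith
      have ha' : v (hi a) ≤ (2 : ℝ) ^ (-(2 * ℓ)) := by
        calc v (hi a) ≤ v a ^ 2 := hsq a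
          _ ≤ ((2 : ℝ) ^ (-ℓ)) ^ 2 := pow_le_pow_left₀ (hv0 a) ha 2
          _ = (2 : ℝ) ^ (-(2 * ℓ)) := by
              rw [← Real.rpow_natCast, ← Real.rpow_mul zero_le_two]
              congr 1
              push_cast
              ring
      have h := le_rpow_of_path hv0 hsq hdb R s j (hi a) (2 * ℓ) (R - 1) ha' hc' hrun.2
      refine h.trans (Real.rpow_le_rpow_of_exponent_le one_le_two ?_)
      rw [pow_succ, neg_le_neg_iff]
      have h2 : (0 : ℝ) ≤ 2 ^ nhi s j := pow_nonneg zero_le_two _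
      nlinarith

/-- **Bootstrapping, counted form.**  Under the same hypotheses, if `v a ≤ 2^{-2R}` with `R ≥ 1`
then every leaf at depth `s` with `v > 2^{-2^K}` is reached with fewer than `K` `hi` steps or
through a run of `R` `lo` steps; hence there are at most `3^s/2^{s+1-K} + s 2^s/2^R` of them.
[cite: ArikanTelatar2009, Thm 1 (proof, §III)] -/
theorem card_lt_v_tleaf_le (hv0 : ∀ a, 0 ≤ v a) (hsq : ∀ a, v (hi a) ≤ v a ^ 2)
    (hdb : ∀ a, v (lo a) ≤ 2 * v a) {R : ℕ} (hR : 0 < R) (s K : ℕ) (a : α)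
    (ha : v a ≤ (2 : ℝ) ^ (-(2 * R : ℝ))) :
    ((univ.filter fun j : Fin (2 ^ s) =>
        (2 : ℝ) ^ (-(2 ^ K : ℝ)) < v (tleaf lo hi a s j)).card : ℝ) ≤
      (3 : ℝ) ^ s / 2 ^ (s + 1 - K) + s * 2 ^ s / 2 ^ R := by
  classical
  have hsub : (univ.filter fun j : Fin (2 ^ s) => (2 : ℝ) ^ (-(2 ^ K : ℝ)) < v (tleaf lo hi a s j)) ⊆
      (univ.filter fun j : Fin (2 ^ s) => nhi s j < K) ∪
        (univ.filter fun j : Fin (2 ^ s) => hasLoRun R s j = true) := by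
    intro j hj
    have hj := (Finset.mem_filter.1 hj).2
    rw [Finset.mem_union, Finset.mem_filter, Finset.mem_filter]
    by_contra hcon
    rw [not_or, not_and, not_and] at hcon
    have hK : K ≤ nhi s j := not_lt.1 (hcon.1 (mem_univ _))
    have hrun : hasLoRun R s j = false := by
      have := hcon.2 (mem_univ _)
      rwa [Bool.not_eq_true] at this
    have hinit : (initLo s j : ℝ) ≤ R - 1 := by
      have h1 : initLo s j + 1 ≤ R := by
        by_contra h
        have h' := hasLoRun_of_le_initLo (s := s) (j := j) (R := R) (by omega)
        rw [hrun] at h'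
        exact Bool.false_ne_true h'
      have : ((initLo s j + 1 : ℕ) : ℝ) ≤ R := by exact_mod_cast h1
      push_cast at this
      linarith
    have hle := le_rpow_of_path lo hi v hv0 hsq hdb R s j a (2 * R) (R - 1) ha hinit hrun
    have hle' : v (tleaf lo hi a s j) ≤ (2 : ℝ) ^ (-(2 ^ K : ℝ)) := by
      refine hle.trans (Real.rpow_le_rpow_of_exponent_le one_le_two ?_)
      rw [show (2 * R - (R - 1) - R : ℝ) = 1 by ring, mul_one, neg_le_neg_iff]
      exact_mod_cast Nat.pow_le_pow_right two_pos hK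
    exact absurd hj (not_lt.2 hle')
  have h1 : ((univ.filter fun j : Fin (2 ^ s) => nhi s j < K).card : ℝ) ≤ (3 : ℝ) ^ s / 2 ^ (s + 1 - K) := by
    rw [le_div_iff₀ (by positivity)]
    exact_mod_cast card_nhi_lt_mul_le s K
  have h2 : ((univ.filter fun j : Fin (2 ^ s) => hasLoRun R s j = true).card : ℝ) ≤
      s * 2 ^ s / 2 ^ R := by
    rw [le_div_iff₀ (by positivity)]
    exact_mod_cast card_hasLoRun_mul_le R hR s
  calc ((univ.filter fun j : Fin (2 ^ s) => (2 : ℝ) ^ (-(2 ^ K : ℝ)) < v (tleaf lo hi a s j)).card : ℝ)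
      ≤ ((univ.filter fun j : Fin (2 ^ s) => nhi s j < K).card : ℝ) +
          ((univ.filter fun j : Fin (2 ^ s) => hasLoRun R s j = true).card : ℝ) := by
        exact_mod_cast (Finset.card_le_card hsub).trans (Finset.card_union_le _ _)
    _ ≤ _ := add_le_add h1 h2

end Process

/-! ### D. The polarization tree of a source: leaves, the potential `√(Z(1−Z²))`, the two processes -/

section Source

/-- **The leakage profile is the conditional entropy of the leaves of the `(minus, plus)`-tree**:
`leak S.g s j = H(leaf j)`, the top bit of `j` choosing the first step (natural index order).
[cite: Arikan2010, §III (recursive computation of H(U_i | U^{i-1}, Y^N))] -/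
theorem leak_eq_H_tleaf : ∀ (s : ℕ) (S : Src) (j : Fin (2 ^ s)),
    leak S.g s j = (tleaf Src.minus Src.plus S s j).H
  | 0, S, j => by rw [tleaf_zero, leak_zero, Src.H_def]
  | s + 1, S, j => by
    rcases eq_loIdx_or_eq_hiIdx s j with ⟨c, rfl⟩ | ⟨c, rfl⟩
    · rw [leak_succ_lo, tleaf_succ_lo, leak_eq_H_tleaf s S.minus c]
    · rw [leak_succ_hi, tleaf_succ_hi, leak_eq_H_tleaf s S.plus c]

/-- The polarization POTENTIAL `φ(S) = √(Z (1 − Z²))` of a source (vanishes exactly at the two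
polarized ends `Z = 0`, `Z = 1`). [cite: MondelliHassaniUrbanke2016, Lemma 5 (a potential g_α(Z) contracting under one step)] -/
def pot (S : Src) : ℝ :=
  Real.sqrt (S.zParam * (1 - S.zParam ^ 2))

/-- `0 ≤ φ`. [folklore] -/
theorem pot_nonneg (S : Src) : 0 ≤ pot S :=
  Real.sqrt_nonneg _

/-- `φ ≤ 1`. [folklore] -/
theorem pot_le_one (S : Src) : pot S ≤ 1 := by
  unfold pot
  rw [Real.sqrt_le_one]
  have h0 := S.zParam_nonneg
  have h1 := S.zParam_le_one
  nlinarith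

/-- `φ² = Z · (1 − Z²)`. [folklore] -/
theorem pot_sq (S : Src) : pot S ^ 2 = S.zParam * (1 - S.zParam ^ 2) := by
  unfold pot
  refine Real.sq_sqrt (mul_nonneg S.zParam_nonneg ?_)
  have h0 := S.zParam_nonneg
  have h1 := S.zParam_le_one
  nlinarith

/-- **The one-variable inequality behind the contraction of the potential**: for `z ∈ [0, 1]`,
`√(z(1+z²)) + √((2−z)(1−z²)) ≤ 19/10` (the maximum is `≈ 1.8521` at `z ≈ 0.539`).  Squaring
twice reduces it to the quartic `4z⁴ − 6.44z³ + 10.44z² − 8z + 2.5921 ≥ 0`, which is the sum of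
`(2z² − 1.61z + 1)²` and a positive definite quadratic. [folklore] -/
theorem sqrt_add_sqrt_le {z : ℝ} (h0 : 0 ≤ z) (h1 : z ≤ 1) :
    Real.sqrt (z * (1 + z ^ 2)) + Real.sqrt ((2 - z) * (1 - z ^ 2)) ≤ 19 / 10 := by
  set A := z * (1 + z ^ 2) with hA
  set B := (2 - z) * (1 - z ^ 2) with hB
  have hA0 : 0 ≤ A := by positivity
  have hz2 : z ^ 2 ≤ 1 := by nlinarith
  have hB0 : 0 ≤ B := mul_nonneg (by linarith) (by linarith)
  have hsum : A + B ≤ 2 := by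
    rw [hA, hB]
    nlinarith [mul_nonneg (mul_nonneg h0 h0) (sub_nonneg.2 h1)]
  have hpoly : 4 * (A * B) ≤ (361 / 100 - A - B) ^ 2 := by
    have key : (361 / 100 - A - B) ^ 2 - 4 * (A * B) =
        4 * z ^ 4 - 161 / 25 * z ^ 3 + 261 / 25 * z ^ 2 - 8 * z + 25921 / 10000 := by
      rw [hA, hB]
      ring
    nlinarith [key, sq_nonneg (2 * z ^ 2 - 161 / 100 * z + 1), sq_nonneg (38479 * z - 23900)]
  have hab : 2 * (Real.sqrt A * Real.sqrt B) ≤ 361 / 100 - A - B := by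
    have h3 : 0 ≤ 361 / 100 - A - B := by linarith
    rw [← Real.sqrt_mul hA0, show (2 : ℝ) = Real.sqrt 4 by
      rw [show (4 : ℝ) = 2 ^ 2 by norm_num, Real.sqrt_sq zero_le_two], ← Real.sqrt_mul (by norm_num),
      ← Real.sqrt_sq h3]
    exact Real.sqrt_le_sqrt hpoly
  have hsq : (Real.sqrt A + Real.sqrt B) ^ 2 ≤ (19 / 10) ^ 2 := by
    rw [add_sq, Real.sq_sqrt hA0, Real.sq_sqrt hB0]
    nlinarith [hab]
  nlinarith [hsq, Real.sqrt_nonneg A, Real.sqrt_nonneg B]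

/-- **Contraction of the potential under one polarization step**:
`φ(S⁻) + φ(S⁺) ≤ 1.9 φ(S)`.  From `Z⁺ = Z²`: `φ(S⁺) = φ(S) √(Z(1+Z²))`; from `Z⁻ ≤ 2Z − Z²` and
`1 − (Z⁻)² ≤ (1 − Z²)²` (i.e. `Z⁻ ≥ Z√(2−Z²)`): `φ(S⁻) ≤ φ(S) √((2−Z)(1−Z²))`; then
`sqrt_add_sqrt_le`. [cite: MondelliHassaniUrbanke2016, Lemma 5–6 (sup over the one-step range of Z⁻ of a potential)] -/
theorem pot_step (S : Src) : pot S.minus + pot S.plus ≤ 19 / 10 * pot S := by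
  have h0 := S.zParam_nonneg
  have h1 := S.zParam_le_one
  set Z := S.zParam with hZ
  have hz2 : Z ^ 2 ≤ 1 := by nlinarith
  have hS0 : 0 ≤ 1 - Z ^ 2 := by linarith
  -- plus
  have hplus : pot S.plus = pot S * Real.sqrt (Z * (1 + Z ^ 2)) := by
    unfold pot
    rw [Src.zParam_plus_eq, ← hZ, ← Real.sqrt_mul (mul_nonneg h0 hS0)]
    congr 1
    ring
  -- minus
  have hm0 := S.minus.zParam_nonneg
  have hm1 := S.minus.zParam_le_one
  have hmle : S.minus.zParam ≤ 2 * Z - Z ^ 2 := S.zParam_minus_le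
  have hmge : Z * Real.sqrt (2 - Z ^ 2) ≤ S.minus.zParam := S.zParam_minus_ge
  have hmsq : 1 - S.minus.zParam ^ 2 ≤ (1 - Z ^ 2) ^ 2 := by
    have h2 : 0 ≤ 2 - Z ^ 2 := by linarith
    have h3 : (Z * Real.sqrt (2 - Z ^ 2)) ^ 2 ≤ S.minus.zParam ^ 2 :=
      pow_le_pow_left₀ (mul_nonneg h0 (Real.sqrt_nonneg _)) hmge 2
    rw [mul_pow, Real.sq_sqrt h2] at h3
    nlinarith [h3]
  have hminus : pot S.minus ≤ pot S * Real.sqrt ((2 - Z) * (1 - Z ^ 2)) := by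
    unfold pot
    rw [← hZ, ← Real.sqrt_mul (mul_nonneg h0 hS0)]
    refine Real.sqrt_le_sqrt ?_
    have hm2 : 0 ≤ 1 - S.minus.zParam ^ 2 := by nlinarith
    calc S.minus.zParam * (1 - S.minus.zParam ^ 2) ≤ (2 * Z - Z ^ 2) * (1 - Z ^ 2) ^ 2 :=
          mul_le_mul hmle hmsq hm2 (by nlinarith)
      _ = Z * (1 - Z ^ 2) * ((2 - Z) * (1 - Z ^ 2)) := by ring
  have hg := sqrt_add_sqrt_le h0 h1
  have hp := pot_nonneg S
  calc pot S.minus + pot S.plus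
      ≤ pot S * Real.sqrt ((2 - Z) * (1 - Z ^ 2)) + pot S * Real.sqrt (Z * (1 + Z ^ 2)) := by
        rw [hplus]; exact add_le_add hminus le_rfl
    _ = pot S * (Real.sqrt (Z * (1 + Z ^ 2)) + Real.sqrt ((2 - Z) * (1 - Z ^ 2))) := by ring
    _ ≤ pot S * (19 / 10) := mul_le_mul_of_nonneg_left hg hp
    _ = 19 / 10 * pot S := by ring

/-- **Rough polarization (potential form)**: the sum of the potential over the `2^s` leaves at depth
`s` is at most `1.9^s`. [cite: MondelliHassaniUrbanke2016, Lemma 6 (E[g(Z_n)] ≤ c 2^{-nρ})] -/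
theorem sum_pot_tleaf_le (S : Src) (s : ℕ) :
    ∑ j : Fin (2 ^ s), pot (tleaf Src.minus Src.plus S s j) ≤ (19 / 10 : ℝ) ^ s := by
  have h := sum_tleaf_le_pow Src.minus Src.plus pot (19 / 10) (by norm_num) pot_step s S
  exact h.trans (mul_le_of_le_one_right (pow_nonneg (by norm_num) s) (pot_le_one S))

/-- If the potential is small then the source is roughly polarized: `φ(S) ≤ η` forces `Z ≤ η` or
`1 − Z² ≤ η`. [folklore] -/
theorem zParam_le_or_le_of_pot_le (S : Src) {η : ℝ} (hη : 0 ≤ η) (h : pot S ≤ η) :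
    S.zParam ≤ η ∨ 1 - S.zParam ^ 2 ≤ η := by
  by_contra hcon
  rw [not_or, not_le, not_le] at hcon
  have h2 : η ^ 2 < pot S ^ 2 := by
    rw [pot_sq]
    calc η ^ 2 = η * η := sq η
      _ < S.zParam * (1 - S.zParam ^ 2) := mul_lt_mul'' hcon.1 hcon.2 hη hη
  exact absurd (pow_le_pow_left₀ (pot_nonneg S) h 2) (not_le.2 h2)

/-- `H ≤ 2 Z` (from `H ≤ log₂(1 + Z) ≤ Z / ln 2`). [cite: Arikan2010, Prop. 2 (H(X|Y) ≤ log(1 + Z(X|Y)))] -/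
theorem Src.H_le_two_mul_zParam (S : Src) : S.H ≤ 2 * S.zParam := by
  have h0 := S.zParam_nonneg
  have hlog2 : (1 : ℝ) / 2 < Real.log 2 := half_lt_log_two
  calc S.H ≤ Real.logb 2 (1 + S.zParam) := S.H_le_logb
    _ = Real.log (1 + S.zParam) / Real.log 2 := rfl
    _ ≤ S.zParam / Real.log 2 := by
        gcongr
        have := Real.log_le_sub_one_of_pos (by linarith : (0 : ℝ) < 1 + S.zParam)
        linarith
    _ ≤ 2 * S.zParam := by
        rw [div_le_iff₀ (by linarith)]
        nlinarith

/-- `1 − (1 − Z²) ≤ H` (`Z² ≤ H`). [cite: Arikan2010, Prop. 2 (Z(X|Y)² ≤ H(X|Y))] -/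
theorem Src.one_sub_le_H (S : Src) : 1 - (1 - S.zParam ^ 2) ≤ S.H := by
  have := S.sq_zParam_le_H
  linarith

/-- The `Z`-process squares along `plus` steps. [cite: Arikan2009, Prop. 5 (Z(W⁺) = Z(W)²)] -/
theorem zProc_sq (S : Src) : S.plus.zParam ≤ S.zParam ^ 2 :=
  S.zParam_plus_eq.le

/-- The `Z`-process at most doubles along `minus` steps. [cite: Arikan2009, Prop. 5 (Z(W⁻) ≤ 2Z − Z²)] -/
theorem zProc_db (S : Src) : S.minus.zParam ≤ 2 * S.zParam := by
  have := S.zParam_minus_le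
  nlinarith [sq_nonneg S.zParam]

/-- The mirror process `X = 1 − Z²` is nonnegative. [cite: KoradaUrbanke2010, Thm 16 (proof: X_n = 1 − Z_n²)] -/
theorem xProc_nonneg (S : Src) : 0 ≤ 1 - S.zParam ^ 2 := by
  have h0 := S.zParam_nonneg
  have h1 := S.zParam_le_one
  nlinarith

/-- **Korada–Urbanke**: the mirror process squares along `minus` steps, `1 − Z(S⁻)² ≤ (1 − Z²)²`
(from `Z(S⁻) ≥ Z √(2 − Z²)`, Lemma 17). [cite: KoradaUrbanke2010, Thm 16 (proof: 1 − Z_{n+1}² ≤ (1 − Z_n²)² w.p. ½)] -/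
theorem xProc_sq (S : Src) : 1 - S.minus.zParam ^ 2 ≤ (1 - S.zParam ^ 2) ^ 2 := by
  have h0 := S.zParam_nonneg
  have h1 := S.zParam_le_one
  have h2 : 0 ≤ 2 - S.zParam ^ 2 := by nlinarith
  have h3 : (S.zParam * Real.sqrt (2 - S.zParam ^ 2)) ^ 2 ≤ S.minus.zParam ^ 2 :=
    pow_le_pow_left₀ (mul_nonneg h0 (Real.sqrt_nonneg _)) S.zParam_minus_ge 2
  rw [mul_pow, Real.sq_sqrt h2] at h3
  nlinarith [h3]

/-- The mirror process at most doubles along `plus` steps: `1 − Z(S⁺)² = 1 − Z⁴ ≤ 2(1 − Z²)`.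
[cite: KoradaUrbanke2010, Thm 16 (proof: 1 − Z_{n+1}² = 1 − Z_n⁴ ≤ 2(1 − Z_n²) w.p. ½)] -/
theorem xProc_db (S : Src) : 1 - S.plus.zParam ^ 2 ≤ 2 * (1 - S.zParam ^ 2) := by
  rw [S.zParam_plus_eq]
  have h0 := S.zParam_nonneg
  have h1 := S.zParam_le_one
  have hz2 : S.zParam ^ 2 ≤ 1 := by nlinarith
  nlinarith [mul_nonneg (sub_nonneg.2 hz2) (sq_nonneg S.zParam)]

end Source

/-! ### E. Assembly: counting the unpolarized leaves at depth `n₀ + m`, and the constants -/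

section Assembly

/-- A leaf in the entropy window `(ε, 1 − ε)` has `Z > θ` and `1 − Z² > θ` as soon as `2θ ≤ ε`
(`H ≤ 2Z`, `H ≥ Z² = 1 − (1 − Z²)`). [cite: Arikan2010, Prop. 2 (Z² ≤ H ≤ log(1+Z))] -/
theorem window_imp (T : Src) {ε θ : ℝ} (hθ : 2 * θ ≤ ε) (hθ0 : 0 ≤ θ)
    (h : ε < T.H ∧ T.H < 1 - ε) : θ < T.zParam ∧ θ < 1 - T.zParam ^ 2 := by
  constructor
  · by_contra hc
    rw [not_lt] at hc
    have := T.H_le_two_mul_zParam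
    linarith [h.1]
  · by_contra hc
    rw [not_lt] at hc
    have := T.one_sub_le_H
    linarith [h.2]

/-- **The two-phase count.**  For a source `S`, depths `n₀` (rough phase) and `m` (fine phase), a
run threshold `R ≥ 1`, a target number `K` of squarings and any `ε ≥ 2 · 2^{-2^K}`: the number of
leaves at depth `n₀ + m` with `H ∈ (ε, 1 − ε)` is at most
`2^m 2^{2R} 1.9^{n₀} + 2^{n₀} (3^m / 2^{m+1-K} + m 2^m / 2^R)`.
The three terms: depth-`n₀` nodes with potential `φ ≥ 2^{-2R}` (Markov on `Σ φ ≤ 1.9^{n₀}`), and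
below a node with `Z ≤ 2^{-2R}` resp. `1 − Z² ≤ 2^{-2R}` the exceptional paths of the bootstrapping
lemma for the process `Z` resp. `1 − Z²`.
[cite: KoradaUrbanke2010, Thm 16 (proof); ArikanTelatar2009, Thm 1 (proof)] -/
theorem card_window_le (S : Src) (n₀ m R K : ℕ) (hR : 0 < R) (ε : ℝ)
    (hε : 2 * (2 : ℝ) ^ (-(2 ^ K : ℝ)) ≤ ε) :
    ((univ.filter fun j : Fin (2 ^ (n₀ + m)) =>
        ε < (tleaf Src.minus Src.plus S (n₀ + m) j).H ∧
          (tleaf Src.minus Src.plus S (n₀ + m) j).H < 1 - ε).card : ℝ) ≤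
      2 ^ m * 2 ^ (2 * R) * (19 / 10 : ℝ) ^ n₀ +
        2 ^ n₀ * ((3 : ℝ) ^ m / 2 ^ (m + 1 - K) + m * 2 ^ m / 2 ^ R) := by
  set θ : ℝ := (2 : ℝ) ^ (-(2 ^ K : ℝ)) with hθdef
  set η : ℝ := (2 : ℝ) ^ (-(2 * R : ℝ)) with hηdef
  set Bnd : ℝ := (3 : ℝ) ^ m / 2 ^ (m + 1 - K) + m * 2 ^ m / 2 ^ R with hBnd
  have hθ0 : 0 < θ := Real.rpow_pos_of_pos two_pos _
  have hη0 : 0 < η := Real.rpow_pos_of_pos two_pos _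
  have hηinv : η⁻¹ = 2 ^ (2 * R) := by
    rw [hηdef, Real.rpow_neg zero_le_two, inv_inv]
    exact_mod_cast Real.rpow_natCast (2 : ℝ) (2 * R)
  have hBnd0 : 0 ≤ Bnd := by positivity
  set W : Src → ℝ := fun T => if ε < T.H ∧ T.H < 1 - ε then 1 else 0 with hW
  -- the inner sums
  have hinner : ∀ A : Src,
      ∑ b : Fin (2 ^ m), W (tleaf Src.minus Src.plus A m b) ≤ Bnd + 2 ^ m / η * pot A := by
    intro A
    have hWle : ∀ (T : Src) (P : Prop) [Decidable P], (ε < T.H ∧ T.H < 1 - ε → P) →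
        W T ≤ if P then 1 else 0 := by
      intro T P _ hP
      simp only [hW]
      split_ifs with h1 h2
      · exact le_rfl
      · exact absurd (hP h1) h2
      · exact zero_le_one
      · exact le_rfl
    have hsumZ : ∑ b : Fin (2 ^ m), W (tleaf Src.minus Src.plus A m b) ≤
        ((univ.filter fun b : Fin (2 ^ m) =>
          θ < (tleaf Src.minus Src.plus A m b).zParam).card : ℝ) := by
      rw [Finset.natCast_card_filter]
      exact Finset.sum_le_sum fun b _ => hWle _ _ fun h => (window_imp _ hε hθ0.le h).1
    have hsumX : ∑ b : Fin (2 ^ m), W (tleaf Src.minus Src.plus A m b) ≤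
        ((univ.filter fun b : Fin (2 ^ m) =>
          θ < 1 - (tleaf Src.plus Src.minus A m b).zParam ^ 2).card : ℝ) := by
      rw [Finset.natCast_card_filter,
        ← sum_tleaf_swap Src.minus Src.plus (fun T : Src => if θ < 1 - T.zParam ^ 2 then (1 : ℝ) else 0)]
      exact Finset.sum_le_sum fun b _ => hWle _ _ fun h => (window_imp _ hε hθ0.le h).2
    have hsum1 : ∑ b : Fin (2 ^ m), W (tleaf Src.minus Src.plus A m b) ≤ 2 ^ m := by
      calc ∑ b : Fin (2 ^ m), W (tleaf Src.minus Src.plus A m b) ≤ ∑ _b : Fin (2 ^ m), (1 : ℝ) := by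
            refine Finset.sum_le_sum fun b _ => ?_
            simp only [hW]
            split_ifs
            · exact le_rfl
            · exact zero_le_one
        _ = 2 ^ m := by simp
    rcases le_or_gt (pot A) η with hp | hp
    · have hcase : ∑ b : Fin (2 ^ m), W (tleaf Src.minus Src.plus A m b) ≤ Bnd := by
        rcases zParam_le_or_le_of_pot_le A hη0.le hp with hZ | hX
        · exact hsumZ.trans (card_lt_v_tleaf_le Src.minus Src.plus Src.zParam Src.zParam_nonneg
            zProc_sq zProc_db hR m K A hZ)
        · exact hsumX.trans (card_lt_v_tleaf_le Src.plus Src.minus (fun T : Src => 1 - T.zParam ^ 2)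
            xProc_nonneg xProc_sq xProc_db hR m K A hX)
      have : 0 ≤ 2 ^ m / η * pot A := by have := pot_nonneg A; positivity
      linarith
    · have hcase : (2 : ℝ) ^ m ≤ 2 ^ m / η * pot A := by
        rw [div_mul_eq_mul_div, le_div_iff₀ hη0]
        exact mul_le_mul_of_nonneg_left hp.le (by positivity)
      linarith
  -- assemble
  rw [Finset.natCast_card_filter, sum_tleaf_add Src.minus Src.plus W n₀ m S]
  calc ∑ i : Fin (2 ^ n₀), ∑ b : Fin (2 ^ m), W (tleaf Src.minus Src.plus (tleaf Src.minus Src.plus S n₀ i) m b)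
      ≤ ∑ i : Fin (2 ^ n₀), (Bnd + 2 ^ m / η * pot (tleaf Src.minus Src.plus S n₀ i)) :=
        Finset.sum_le_sum fun i _ => hinner _
    _ = 2 ^ n₀ * Bnd + 2 ^ m / η * ∑ i : Fin (2 ^ n₀), pot (tleaf Src.minus Src.plus S n₀ i) := by
        rw [Finset.sum_add_distrib, Finset.sum_const, Finset.card_univ, Fintype.card_fin, ← Finset.mul_sum,
          nsmul_eq_mul, Nat.cast_pow, Nat.cast_ofNat]
    _ ≤ 2 ^ n₀ * Bnd + 2 ^ m / η * (19 / 10 : ℝ) ^ n₀ := by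
        gcongr
        exact sum_pot_tleaf_le S n₀
    _ = 2 ^ m * 2 ^ (2 * R) * (19 / 10 : ℝ) ^ n₀ + 2 ^ n₀ * Bnd := by
        rw [div_eq_mul_inv, hηinv, add_comm]

/-- `(19/10)^14 < 2^13`, so `1.9^{266k} ≤ 2^{247k}`. [folklore] -/
theorem pow_nineteen_tenths_le (k : ℕ) : (19 / 10 : ℝ) ^ (266 * k) ≤ 2 ^ (247 * k) := by
  have h14 : (19 / 10 : ℝ) ^ 14 ≤ 2 ^ 13 := by norm_num
  calc (19 / 10 : ℝ) ^ (266 * k) = ((19 / 10 : ℝ) ^ 14) ^ (19 * k) := by rw [← pow_mul]; ring_nf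
    _ ≤ ((2 : ℝ) ^ 13) ^ (19 * k) := pow_le_pow_left₀ (by positivity) h14 _
    _ = 2 ^ (247 * k) := by rw [← pow_mul]; ring_nf

/-- `3^5 < 2^8`, so `3^t ≤ 2^{8(t/5 + 1)}`. [folklore] -/
theorem three_pow_le (t : ℕ) : (3 : ℝ) ^ t ≤ 2 ^ (8 * (t / 5 + 1)) := by
  calc (3 : ℝ) ^ t ≤ 3 ^ (5 * (t / 5 + 1)) := pow_le_pow_right₀ (by norm_num) (by omega)
    _ = ((3 : ℝ) ^ 5) ^ (t / 5 + 1) := by rw [pow_mul]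
    _ ≤ ((2 : ℝ) ^ 8) ^ (t / 5 + 1) := pow_le_pow_left₀ (by positivity) (by norm_num) _
    _ = 2 ^ (8 * (t / 5 + 1)) := by rw [← pow_mul]

/-- `1024 (k + 1) ≤ 2^{5k}` for `k ≥ 3`. [folklore] -/
theorem lin_le_two_pow_five_mul : ∀ k : ℕ, 1024 * (k + 3 + 1) ≤ 2 ^ (5 * (k + 3))
  | 0 => by norm_num
  | k + 1 => by
    calc 1024 * (k + 1 + 3 + 1) ≤ 2 * (1024 * (k + 3 + 1)) := by omega
      _ ≤ 2 * 2 ^ (5 * (k + 3)) := Nat.mul_le_mul_left 2 (lin_le_two_pow_five_mul k)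
      _ ≤ 2 ^ (5 * (k + 1 + 3)) := by
          rw [show 5 * (k + 1 + 3) = 5 * (k + 3) + 5 by ring, pow_add]
          omega

/-- **Fine two-sided polarization** (`PolarizeFine`): with `μ = 3/1024` and `C = 512`, for every
binary source with functional side information and every block length `2^n`, at most
`C · 2^{(1−μ)n}` indices `j` have `H(U_j | U_{<j}, Y) ∈ (2^{-2^{⌊n/4⌋}}, 1 − 2^{-2^{⌊n/4⌋}})`.
Proof: Korada–Urbanke's mirror process `X = 1 − Z²` (`X⁻ ≤ X²`, `X⁺ ≤ 2X`, from Lemma 17) next to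
`Z` (`Z⁺ = Z²`, `Z⁻ ≤ 2Z`); a rough phase of depth `n₀ = 266k` (`k = ⌊n/1024⌋`) driven by the
contracting potential `√(Z(1−Z²))`, then the Arıkan–Telatar bootstrapping over the remaining
`t = n − n₀` levels with run threshold `R = 8k` and `K = ⌊n/4⌋ + 1` squarings
(`card_window_le`); `n < 3072` is absorbed by `C`.
[cite: KoradaUrbanke2010, Thm 16 and Lemma 17] -/
theorem PolarizeFine_holds : PolarizeFine := by
  refine ⟨3 / 1024, by norm_num, 512, ?_⟩
  intro mm β _ g n
  set S : Src := Src.mk mm β g with hSdef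
  -- the trivial bound
  have htriv : ((univ.filter fun j : Fin (2 ^ n) =>
      fineEps n < leak g n j ∧ leak g n j < 1 - fineEps n).card : ℝ) ≤ 2 ^ n := by
    calc ((univ.filter fun j : Fin (2 ^ n) =>
        fineEps n < leak g n j ∧ leak g n j < 1 - fineEps n).card : ℝ)
        ≤ ((univ : Finset (Fin (2 ^ n))).card : ℝ) := by exact_mod_cast Finset.card_filter_le _ _
      _ = 2 ^ n := by simp
  have hrpow : ∀ x : ℝ, (2 : ℝ) ^ x = (2 : ℝ) ^ (x - (1 - 3 / 1024) * n) * 2 ^ ((1 - 3 / 1024) * (n : ℝ)) := by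
    intro x
    rw [← Real.rpow_add two_pos]
    ring_nf
  by_cases hn : n < 3072
  · -- small `n`: `2^n ≤ 512 · 2^{(1-μ)n}`
    refine htriv.trans ?_
    rw [show (2 : ℝ) ^ n = (2 : ℝ) ^ (n : ℝ) from (Real.rpow_natCast 2 n).symm, hrpow n]
    refine mul_le_mul_of_nonneg_right ?_ (by positivity)
    calc (2 : ℝ) ^ ((n : ℝ) - (1 - 3 / 1024) * n) ≤ (2 : ℝ) ^ (9 : ℝ) := by
          refine Real.rpow_le_rpow_of_exponent_le one_le_two ?_
          have : (n : ℝ) ≤ 3072 := by exact_mod_cast hn.le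
          nlinarith
      _ = 512 := by norm_num
  · rw [not_lt] at hn
    -- parameters
    set k := n / 1024 with hk
    have hk3 : 3 ≤ k := by omega
    set t := n - 266 * k with ht
    have hnt : 266 * k + t = n := by omega
    have hR : 0 < 8 * k := by omega
    -- the window threshold `ε = fineEps n` versus `K = n/4 + 1` squarings
    have hε : 2 * (2 : ℝ) ^ (-(2 ^ (n / 4 + 1) : ℝ)) ≤ fineEps n := by
      unfold fineEps
      have hq : (1 : ℝ) ≤ 2 ^ (n / 4) := one_le_pow₀ one_le_two
      rw [← Real.rpow_natCast 2 (2 ^ (n / 4)), ← Real.rpow_neg zero_le_two,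
        show (2 : ℝ) * (2 : ℝ) ^ (-(2 ^ (n / 4 + 1) : ℝ)) = (2 : ℝ) ^ (1 + -(2 ^ (n / 4 + 1) : ℝ)) by
          rw [Real.rpow_add two_pos, Real.rpow_one]]
      refine Real.rpow_le_rpow_of_exponent_le one_le_two ?_
      push_cast
      rw [pow_succ]
      linarith
    -- the count at depth `266k + t`
    have key := card_window_le S (266 * k) t (8 * k) (n / 4 + 1) hR (fineEps n) hε
    rw [hnt] at key
    have hleak : ∀ j : Fin (2 ^ n), leak g n j = (tleaf Src.minus Src.plus S n j).H := fun j =>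
      leak_eq_H_tleaf n S j
    simp_rw [hleak]
    refine key.trans ?_
    -- the three terms are each at most `2^(n - 3k)`
    have h3k : 3 * k ≤ n := by omega
    have hpow2 : ∀ a b : ℕ, a ≤ b → (2 : ℝ) ^ a ≤ 2 ^ b := fun a b h => pow_le_pow_right₀ one_le_two h
    have hterm1 : (2 : ℝ) ^ t * 2 ^ (2 * (8 * k)) * (19 / 10 : ℝ) ^ (266 * k) ≤ 2 ^ (n - 3 * k) := by
      calc (2 : ℝ) ^ t * 2 ^ (2 * (8 * k)) * (19 / 10 : ℝ) ^ (266 * k)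
          ≤ (2 : ℝ) ^ t * 2 ^ (2 * (8 * k)) * 2 ^ (247 * k) := by
            gcongr
            exact pow_nineteen_tenths_le k
        _ = 2 ^ (t + 2 * (8 * k) + 247 * k) := by rw [pow_add, pow_add]
        _ = 2 ^ (n - 3 * k) := by congr 1; omega
    have hterm2 : (2 : ℝ) ^ (266 * k) * ((3 : ℝ) ^ t / 2 ^ (t + 1 - (n / 4 + 1))) ≤ 2 ^ (n - 3 * k) := by
      rw [mul_div_assoc', div_le_iff₀ (by positivity), ← pow_add]
      calc (2 : ℝ) ^ (266 * k) * 3 ^ t ≤ 2 ^ (266 * k) * 2 ^ (8 * (t / 5 + 1)) := by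
            gcongr
            exact three_pow_le t
        _ = 2 ^ (266 * k + 8 * (t / 5 + 1)) := by rw [pow_add]
        _ ≤ 2 ^ (n - 3 * k + (t + 1 - (n / 4 + 1))) := hpow2 _ _ (by omega)
    have hterm3 : (2 : ℝ) ^ (266 * k) * (t * 2 ^ t / 2 ^ (8 * k)) ≤ 2 ^ (n - 3 * k) := by
      have htk : (t : ℝ) ≤ 2 ^ (5 * k) := by
        have h1 : t ≤ 1024 * (k + 1) := by omega
        have h2 : 1024 * (k + 1) ≤ 2 ^ (5 * k) := by
          have := lin_le_two_pow_five_mul (k - 3)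
          rwa [show k - 3 + 3 = k by omega] at this
        exact_mod_cast h1.trans h2
      rw [mul_div_assoc', div_le_iff₀ (by positivity), ← pow_add]
      calc (2 : ℝ) ^ (266 * k) * (t * 2 ^ t) ≤ 2 ^ (266 * k) * (2 ^ (5 * k) * 2 ^ t) := by gcongr
        _ = 2 ^ (266 * k + 5 * k + t) := by rw [pow_add, pow_add]; ring
        _ = 2 ^ (n - 3 * k + 8 * k) := by congr 1; omega
    -- `3 · 2^(n - 3k) ≤ 512 · 2^{(1 - μ) n}`
    have hfin : (2 : ℝ) ^ (n - 3 * k) ≤ 128 * (2 : ℝ) ^ ((1 - 3 / 1024) * (n : ℝ)) := by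
      rw [show (2 : ℝ) ^ (n - 3 * k) = (2 : ℝ) ^ ((n - 3 * k : ℕ) : ℝ) from (Real.rpow_natCast 2 _).symm,
        hrpow]
      refine mul_le_mul_of_nonneg_right ?_ (by positivity)
      calc (2 : ℝ) ^ (((n - 3 * k : ℕ) : ℝ) - (1 - 3 / 1024) * n) ≤ (2 : ℝ) ^ (7 : ℝ) := by
            refine Real.rpow_le_rpow_of_exponent_le one_le_two ?_
            have h1 : ((n - 3 * k : ℕ) : ℝ) = n - 3 * k := by
              rw [Nat.cast_sub h3k]
              push_cast
              ring
            have h2 : (n : ℝ) ≤ 1024 * k + 1024 := by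
              have : n ≤ 1024 * k + 1024 := by omega
              exact_mod_cast this
            rw [h1]
            nlinarith
        _ = 128 := by norm_num
    calc (2 : ℝ) ^ t * 2 ^ (2 * (8 * k)) * (19 / 10 : ℝ) ^ (266 * k) +
          2 ^ (266 * k) * ((3 : ℝ) ^ t / 2 ^ (t + 1 - (n / 4 + 1)) + t * 2 ^ t / 2 ^ (8 * k))
        = (2 : ℝ) ^ t * 2 ^ (2 * (8 * k)) * (19 / 10 : ℝ) ^ (266 * k) +
          (2 ^ (266 * k) * ((3 : ℝ) ^ t / 2 ^ (t + 1 - (n / 4 + 1))) +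
            2 ^ (266 * k) * (t * 2 ^ t / 2 ^ (8 * k))) := by ring
      _ ≤ 2 ^ (n - 3 * k) + (2 ^ (n - 3 * k) + 2 ^ (n - 3 * k)) :=
          add_le_add hterm1 (add_le_add hterm2 hterm3)
      _ = 3 * 2 ^ (n - 3 * k) := by ring
      _ ≤ 3 * (128 * (2 : ℝ) ^ ((1 - 3 / 1024) * (n : ℝ))) := by linarith [hfin]
      _ ≤ 512 * (2 : ℝ) ^ ((1 - 3 / 1024) * (n : ℝ)) := by
          have : 0 ≤ (2 : ℝ) ^ ((1 - 3 / 1024) * (n : ℝ)) := by positivity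
          nlinarith

end Assembly

end Literature.InformationTheory.Coding.Polar

end
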